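import Summits.RiemannHypothesis.RiemannHypothesis.Theorems.ScrewManifestSuperlinearOfJBound
import Summits.RiemannHypothesis.RiemannHypothesis.Theorems.ScrewManifestWeakJBound

/-!
# RH-FREE format theory: the guarded J-bound IS the superlinear floor (`JBoundGuarded ↔ SuperlinearFloor`)

sos-theory g20, closing the logical loop of note 3 (SCREW-P3-PLATEAU-NOTE-g20): the tree has
`JBoundGuarded → SuperlinearFloor` (p479130 `superlinearFloor_of_smallJ`, p480372
`superlinearFloor_of_jBound_guarded`).  The CONVERSE is elementary: if no certificate exists at height
`θ(n+1)` for `n ≥ n₀`, the J-bound is vacuous there, and for the finitely many `1 ≤ n < n₀` every strictly-DD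
remainder has `wJ < S_ii` (`wJ_lt_screw_diag`: dominance of any row and `η ≤ Ψ`), a quantity bounded by a
finite sum.  Hence

* `jBoundGuarded_iff_superlinearFloor : JBoundGuarded ↔ SuperlinearFloor`.

READING.  The "one open input" S2a of the RH-free chain is therefore not logically WEAKER than the floor —
it is the floor RESTATED as a law for ONE certificate scalar, `wJ·(n+1) = O_θ(1)`; its value is that the
scalar is measured per census cell (`0.240, 0.230, 0.222` at `M = 64, 128, 160`), is bounded RH-free by
`O(log(n+1))` uniformly in the height (p479832 `weakJBound`), and has a clean LP-dual characterisation.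

RH-FREE: statements about the certificate FORMAT; nothing here bears on the truth of RH.
References: [folklore].
-/

set_option linter.dupNamespace false
set_option autoImplicit false

noncomputable section

open Finset Real

namespace Summit.RiemannHypothesis.RiemannHypothesis.Theorems.IntegerScrew.Manifest

open Literature.NumberTheory.LFunctions

/-- RH-FREE conjecture slot **S2a, guarded form** (= the hypothesis of `superlinearFloor_of_jBound_guarded`,
p480372): for every slope `θ` the all-ones weight of every strictly-DD manifest certificate of `S_{n+1}`,
`n ≥ 1`, at height `θ(n+1)` is `≤ A(θ)/(n+1)`. -/
def JBoundGuarded : Prop :=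
  ∀ θ : ℝ, 0 < θ → ∃ A : ℝ, ∀ (n K : ℕ) (t w : Fin K → ℝ) (wJ : ℝ), 1 ≤ n →
    (∀ k, 0 < t k ∧ t k ≤ θ * (n + 1) ∧ 0 ≤ w k) → 0 ≤ wJ →
      IsStrictDiagDominant (remainder n K t w wJ) → wJ ≤ A / (n + 1)

-- `η ≤ Ψ` (atom profiles are nonnegative) is the tree's `remainderFn_le_zetaScrew`
-- (`Theorems/ScrewManifestWeakJBound.lean`, p479832); the gate's dedup rule forbids restating it here.

/-- RH-FREE (support): for `n ≥ 1` no vacuity remains — strict dominance of ANY row forces `wJ < S_ii`. -/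
theorem wJ_lt_screw_diag (n K : ℕ) (t w : Fin K → ℝ) (wJ : ℝ) (hw : ∀ k, 0 ≤ w k)
    (hD : IsStrictDiagDominant (remainder n K t w wJ)) (i : Fin n) :
    wJ < screwMatrix n i i := by
  have h1 : 0 < remainder n K t w wJ i i :=
    lt_of_le_of_lt (sum_nonneg fun _ _ => abs_nonneg _) (hD i)
  rw [remainder_apply_remainderFn, sub_self, remainderFn_zero] at h1
  have h2 := remainderFn_le_zetaScrew K t w hw (node n i)
  have hS : screwMatrix n i i =
      zetaScrew (node n i) + zetaScrew (node n i) - zetaScrew (node n i - node n i) := rfl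
  rw [hS, sub_self, zetaScrew_zero]
  linarith

/-- RH-FREE (support): every strictly-DD manifest decomposition with positive frequencies below `T` is a
`ManifestCert n tmin T` for some `tmin > 0`. -/
theorem manifestCert_of_decomposition (n K : ℕ) (t w : Fin K → ℝ) (wJ T : ℝ)
    (hat : ∀ k, 0 < t k ∧ t k ≤ T ∧ 0 ≤ w k) (hwJ : 0 ≤ wJ)
    (hD : IsStrictDiagDominant (remainder n K t w wJ)) :
    ∃ tmin : ℝ, 0 < tmin ∧ ManifestCert n tmin T := by
  classical
  let s : Finset ℝ := insert 1 (univ.image t)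
  have hs : s.Nonempty := ⟨1, mem_insert_self _ _⟩
  refine ⟨s.min' hs, ?_, K, t, w, wJ, fun k => ⟨?_, (hat k).2.1, (hat k).1, (hat k).2.2⟩, hwJ, hD⟩
  · refine (Finset.lt_min'_iff s hs).2 fun x hx => ?_
    rcases mem_insert.1 hx with rfl | hx
    · exact one_pos
    · obtain ⟨k, -, rfl⟩ := mem_image.1 hx
      exact (hat k).1
  · exact Finset.min'_le s (t k) (mem_insert_of_mem (mem_image_of_mem t (mem_univ k)))

/-- RH-FREE: the CONVERSE of the bypass — the superlinear floor implies the guarded J-bound (vacuously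
above `n₀(θ)`, by `wJ < S_ii` and a finite bound below). -/
theorem jBoundGuarded_of_superlinearFloor (h : SuperlinearFloor) : JBoundGuarded := by
  classical
  intro θ hθ
  obtain ⟨n₀, hn₀⟩ := h θ
  -- a bound for the diagonal entries of all `S_{n+1}`, `n ≤ n₀`
  let B : ℝ := ∑ m ∈ range (n₀ + 1), ∑ i : Fin m, |screwMatrix m i i|
  have hB : 0 ≤ B := sum_nonneg fun m _ => sum_nonneg fun i _ => abs_nonneg _
  refine ⟨B * (n₀ + 1), fun n K t w wJ hn hat hwJ hD => ?_⟩
  have hn1 : (0 : ℝ) < (n : ℝ) + 1 := by positivity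
  by_cases hle : n₀ ≤ n
  · -- no certificate exists at this height: contradiction
    obtain ⟨tmin, htmin, hcert⟩ := manifestCert_of_decomposition n K t w wJ _ hat hwJ hD
    exact absurd hcert (hn₀ n hle tmin htmin)
  · rw [not_le] at hle
    let i0 : Fin n := ⟨0, by omega⟩
    have h1 : wJ < screwMatrix n i0 i0 := wJ_lt_screw_diag n K t w wJ (fun k => (hat k).2.2) hD i0
    have h2 : screwMatrix n i0 i0 ≤ |screwMatrix n i0 i0| := le_abs_self _
    have h3 : |screwMatrix n i0 i0| ≤ ∑ i : Fin n, |screwMatrix n i i| :=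
      single_le_sum (f := fun i : Fin n => |screwMatrix n i i|) (fun i _ => abs_nonneg _) (mem_univ i0)
    have h4 : (∑ i : Fin n, |screwMatrix n i i|) ≤ B :=
      single_le_sum (f := fun m => ∑ i : Fin m, |screwMatrix m i i|)
        (fun m _ => sum_nonneg fun i _ => abs_nonneg _) (mem_range.2 (by omega))
    have h5 : B ≤ B * (n₀ + 1) / ((n : ℝ) + 1) := by
      rw [le_div_iff₀ hn1]
      have : (n : ℝ) + 1 ≤ (n₀ : ℝ) + 1 := by exact_mod_cast (by omega : n + 1 ≤ n₀ + 1)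
      nlinarith
    linarith

/-- RH-FREE: the guarded J-bound implies the floor (as p480372 `superlinearFloor_of_jBound_guarded`, via
`superlinearFloor_of_smallJ`; at `n = 0` the empty certificate with `wJ = 0` is the cheap one). -/
theorem superlinearFloor_of_jBoundGuarded (hJ : JBoundGuarded) : SuperlinearFloor := by
  refine superlinearFloor_of_smallJ fun θ hθ => ?_
  obtain ⟨A, hA⟩ := hJ θ hθ
  refine ⟨max A 0, fun n tmin _ hcert => ?_⟩
  obtain ⟨K, t, w, wJ, hat, hwJ, hDD⟩ := hcert
  have hat' : ∀ k, 0 < t k ∧ t k ≤ θ * (n + 1) ∧ 0 ≤ w k :=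
    fun k => ⟨(hat k).2.2.1, (hat k).2.1, (hat k).2.2.2⟩
  have hn1 : (0 : ℝ) < (n : ℝ) + 1 := by positivity
  rcases Nat.eq_zero_or_pos n with hn | hn
  · subst hn
    refine ⟨0, Fin.elim0, Fin.elim0, 0, fun k => Fin.elim0 k, le_rfl, ?_, fun i => Fin.elim0 i⟩
    exact div_nonneg (le_max_right _ _) hn1.le
  · have h := hA n K t w wJ hn hat' hwJ hDD
    exact ⟨K, t, w, wJ, hat', hwJ,
      le_trans h (div_le_div_of_nonneg_right (le_max_left _ _) hn1.le), hDD⟩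

/-- **RH-FREE: the guarded J-bound IS the superlinear floor.** -/
theorem jBoundGuarded_iff_superlinearFloor : JBoundGuarded ↔ SuperlinearFloor :=
  ⟨superlinearFloor_of_jBoundGuarded, jBoundGuarded_of_superlinearFloor⟩

end Summit.RiemannHypothesis.RiemannHypothesis.Theorems.IntegerScrew.Manifest
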